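import Summits.ValiantsHypothesis.ValiantsHypothesis.Theses.SOSTau
import Literature.Computability.AlgebraicComplexity.RealTauKnownCases

/-!
# Crux `SOSTau.SOSTau` (stmt-ValiantsHypothesis-18748), line `Sketch` — stub
`stub_robustOfGaussPair`: the Gaussian-pair inequalities imply the robust-excursion count

For a real weighted sum of sparse squares `F = Σᵢ aᵢ gᵢ²` with majorant `M = Σᵢ |aᵢ| gᵢ²`, positive
zeros `0 < z₀ < z₁ < ⋯ < z_N` of `F`, and a set `K` of indices `k` whose excursion `(z_k, z_{k+1})`
contains a ROBUST point `t` (`M(t)/2 < |F(t)|`), we prove `|K| ≤ C · S`, `S = Σᵢ |supp gᵢ|`, with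
`C = ⌈2/κ⌉₊ + 1` depending only on the constant `κ` of the Gaussian-pair hypothesis (stub
`stub_gaussPair` of the line, assumed here as the antecedent).

Proof.  Write `aᵢ = uᵢ² - vᵢ²`, `|aᵢ| = uᵢ² + vᵢ²`, `uᵢvᵢ = 0`, and lift `x` to the two blocks
`U_x = (uᵢ gᵢ(x))ᵢ`, `V_x = (vᵢ gᵢ(x))ᵢ` of `ℝˢ`: `⟪U_x, V_x⟫ = 0`, `‖U_x‖² - ‖V_x‖² = F(x)`,
`‖U_x‖² + ‖V_x‖² = M(x)`.  For a standard Gaussian `c ∈ ℝˢ` the section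
`D_c(x) = ⟪c, U_x⟫² - ⟪c, V_x⟫²` is the polynomial `(L₊ - L₋)(L₊ + L₋)`, `L± = Σᵢ cᵢ uᵢ gᵢ` resp.
`Σᵢ cᵢ vᵢ gᵢ`, a product of two linear combinations of the `gᵢ`, so it has `< 2S` distinct
positive zeros (sparse Descartes, `card_roots_toFinset_filter_pos_lt_card_support`).  GOOD indices
(`M(z_k) > 0`): at `z_k`, `‖U‖ = ‖V‖ > 0`, so `D_c(z_k)` has either sign with probability `≥ 1/2`;
at the robust point one block dominates (`‖U‖² ≥ 3‖V‖²` or conversely), so `D_c(t_k)` has the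
dominant sign with probability `≥ 1/2 + κ`; hence `D_c` changes sign on `(z_k, t_k)` with
probability `≥ κ` (inclusion–exclusion), while for every fixed `c` this happens for at most `2S`
indices (intermediate value theorem on the disjoint intervals `(z_k, t_k)`); integrating the
counting function gives `κ · #good ≤ 2S`.  BAD indices (`M(z_k) = 0`): `z_k` is a positive zero
of a fixed `g_{i₀}` with `a_{i₀} ≠ 0`, `g_{i₀} ≠ 0` (which exists since `F ≠ 0` once `K ≠ ∅`),
so `#bad < |supp g_{i₀}| ≤ S`. [folklore]
-/

noncomputable section

-- `Summit.ValiantsHypothesis.ValiantsHypothesis.…` is the tree's mandated layout (Sub = Summit).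
set_option linter.dupNamespace false

namespace Summit.ValiantsHypothesis.ValiantsHypothesis.Theorems.SOSTauSOSTau

open Polynomial MeasureTheory ProbabilityTheory Finset
open Literature.Computability.AlgebraicComplexity

/-! ### Sparse Descartes for the Gaussian section -/

/-- A product of two linear combinations `Σ pᵢ gᵢ`, `Σ qᵢ gᵢ` has at most `2 Σ |supp gᵢ|`
distinct positive zeros (each factor has at most `Σ |supp gᵢ|` monomials). [folklore] -/
theorem card_pos_roots_mul_linComb_le {s : ℕ} (p q : Fin s → ℝ) (g : Fin s → ℝ[X]) :
    ((((∑ i, C (p i) * g i) * ∑ i, C (q i) * g i).roots.toFinset.filter (0 < ·)).card) ≤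
      2 * ∑ i, (g i).support.card := by
  classical
  have hsupp : ∀ w : Fin s → ℝ, (∑ i, C (w i) * g i).support.card ≤ ∑ i, (g i).support.card :=
    fun w => (card_support_sum_le _ _).trans (Finset.sum_le_sum fun i _ => by
      rw [C_mul']
      exact Finset.card_le_card (support_smul _ _))
  by_cases h : (∑ i, C (p i) * g i) * (∑ i, C (q i) * g i) = 0
  · rw [h, roots_zero, Multiset.toFinset_zero, Finset.filter_empty, Finset.card_empty]
    exact Nat.zero_le _
  obtain ⟨hp, hq⟩ := mul_ne_zero_iff.mp h
  rw [roots_mul h, Multiset.toFinset_add, Finset.filter_union]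
  calc _ ≤ _ := Finset.card_union_le _ _
    _ ≤ (∑ i, (g i).support.card) + ∑ i, (g i).support.card :=
        add_le_add ((card_roots_toFinset_filter_pos_lt_card_support hp).le.trans (hsupp p))
          ((card_roots_toFinset_filter_pos_lt_card_support hq).le.trans (hsupp q))
    _ = _ := by ring

/-- **Sign changes on disjoint excursions are paid for by distinct positive zeros.**  If
`0 < z₀ < z₁ < ⋯ < z_N` and, for every `k ∈ T`, a real polynomial `P` takes values of opposite
signs at `z_k` and at some `t_k ∈ (z_k, z_{k+1})`, then `|T|` is at most the number of distinct
positive zeros of `P` (intermediate value theorem on the pairwise disjoint intervals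
`(z_k, t_k)`). [folklore] -/
theorem card_le_card_pos_roots_of_sign_changes {N : ℕ} (z : Fin (N + 1) → ℝ) (hz : StrictMono z)
    (hz0 : 0 < z 0) (t : Fin N → ℝ) (P : ℝ[X]) (T : Finset (Fin N))
    (hT : ∀ k ∈ T, z k.castSucc < t k ∧ t k < z k.succ ∧
      P.eval (z k.castSucc) * P.eval (t k) < 0) :
    T.card ≤ (P.roots.toFinset.filter (0 < ·)).card := by
  classical
  rcases T.eq_empty_or_nonempty with rfl | ⟨k₀, hk₀⟩
  · simp
  have hP : P ≠ 0 := by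
    rintro rfl
    have := (hT k₀ hk₀).2.2
    simp at this
  -- a zero `r k ∈ (z_k, t_k)` for every `k ∈ T`
  have hr : ∀ k, ∃ r : ℝ, k ∈ T → z k.castSucc < r ∧ r < t k ∧ P.eval r = 0 := by
    intro k
    by_cases hk : k ∈ T
    · obtain ⟨h1, -, h3⟩ := hT k hk
      have hz' : P.eval (z k.castSucc) ≠ 0 := fun h => by simp [h] at h3
      obtain ⟨r, hr, hr0⟩ := intermediate_value_Ioo'
        (f := fun x => P.eval (z k.castSucc) * P.eval x) h1.le (by fun_prop)
        ⟨h3, mul_self_pos.mpr hz'⟩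
      exact ⟨r, fun _ => ⟨hr.1, hr.2, (mul_eq_zero.mp hr0).resolve_left hz'⟩⟩
    · exact ⟨0, fun h => absurd h hk⟩
  choose r hr using hr
  refine Finset.card_le_card_of_injOn r (fun k hk => ?_) ?_
  · obtain ⟨h1, -, h3⟩ := hr k (Finset.mem_coe.mp hk)
    have h0 : z 0 ≤ z k.castSucc := hz.monotone (Fin.zero_le _)
    simp only [Finset.coe_filter, Set.mem_setOf_eq, Multiset.mem_toFinset, mem_roots hP,
      IsRoot.def]
    exact ⟨h3, by linarith⟩
  · intro k hk k' hk' hkk'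
    by_contra hne
    rcases lt_or_gt_of_ne hne with hlt | hlt
    · have hzz : z k.succ ≤ z k'.castSucc := hz.monotone (Fin.succ_le_castSucc_iff.mpr hlt)
      linarith [(hr k hk).2.1, (hT k hk).2.1, (hr k' hk').1]
    · have hzz : z k'.succ ≤ z k.castSucc := hz.monotone (Fin.succ_le_castSucc_iff.mpr hlt)
      linarith [(hr k' hk').2.1, (hT k' hk').2.1, (hr k hk).1]

/-! ### Probability bookkeeping -/

open scoped Classical in
/-- **Fubini count.**  If every point of a probability space lies in at most `B` of the
measurable sets `E k`, `k ∈ T`, then `Σ_{k ∈ T} μ(E k) ≤ B`. [folklore] -/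
theorem sum_measureReal_le_of_card_filter_le {Ω ι : Type*} [MeasurableSpace Ω] (μ : Measure Ω)
    [IsProbabilityMeasure μ] (T : Finset ι) (E : ι → Set Ω) (hE : ∀ k ∈ T, MeasurableSet (E k))
    (B : ℕ) (hB : ∀ ω, (T.filter (fun k => ω ∈ E k)).card ≤ B) :
    ∑ k ∈ T, μ.real (E k) ≤ B := by
  have hint : ∀ k ∈ T, Integrable (fun ω => (E k).indicator (1 : Ω → ℝ) ω) μ :=
    fun k hk => (integrable_const (1 : ℝ)).indicator (hE k hk)
  have h1 : ∀ k ∈ T, μ.real (E k) = ∫ ω, (E k).indicator (1 : Ω → ℝ) ω ∂μ :=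
    fun k hk => (integral_indicator_one (hE k hk)).symm
  rw [Finset.sum_congr rfl h1, ← integral_finsetSum _ hint]
  calc ∫ ω, ∑ k ∈ T, (E k).indicator (1 : Ω → ℝ) ω ∂μ ≤ ∫ _, (B : ℝ) ∂μ := by
        refine integral_mono (integrable_finsetSum _ hint) (integrable_const _) fun ω => ?_
        have : ∑ k ∈ T, (E k).indicator (1 : Ω → ℝ) ω = ((T.filter (fun k => ω ∈ E k)).card : ℝ) := by
          simp only [Set.indicator_apply, Pi.one_apply, Finset.sum_boole]
        rw [this, Nat.cast_le]
        convert hB ω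
    _ = B := by simp

/-- Inclusion–exclusion for a probability measure: if `1/2 ≤ μ A`, `1/2 + κ ≤ μ B` (`B`
measurable) and `A ∩ B ⊆ E`, then `κ ≤ μ E`. [folklore] -/
theorem le_measureReal_of_inter_subset {Ω : Type*} [MeasurableSpace Ω] (μ : Measure Ω)
    [IsProbabilityMeasure μ] {κ : ℝ} {A B E : Set Ω} (hB : MeasurableSet B)
    (hA : 1 / 2 ≤ μ.real A) (hB' : 1 / 2 + κ ≤ μ.real B) (h : A ∩ B ⊆ E) : κ ≤ μ.real E := by
  have h1 := measureReal_union_add_inter (μ := μ) (s := A) hB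
  have h2 : μ.real (A ∪ B) ≤ 1 := measureReal_le_one
  have h3 := measureReal_mono (μ := μ) h (measure_ne_top _ _)
  linarith

/-- **One robust excursion costs probability `κ`.**  For orthogonal pairs `(U₀, V₀)` (at the zero:
`‖U₀‖ = ‖V₀‖ > 0`) and `(U₁, V₁)` (at the robust point: `(‖U₁‖² + ‖V₁‖²)/2 < |‖U₁‖² - ‖V₁‖²|`),
the Gaussian sign-change event `{c | (⟪c,U₀⟫² - ⟪c,V₀⟫²) · (⟪c,U₁⟫² - ⟪c,V₁⟫²) < 0}` has
probability at least `κ`, granted the Gaussian-pair inequalities. [folklore] -/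
theorem le_measureReal_signChange {κ : ℝ} {n : ℕ}
    (hG : ∀ (U V : EuclideanSpace ℝ (Fin n)), inner ℝ U V = 0 → 0 < ‖U‖ →
      (‖U‖ = ‖V‖ →
        (1 / 2 : ℝ) ≤ (stdGaussian (EuclideanSpace ℝ (Fin n))).real
          {c | inner ℝ c U ^ 2 < inner ℝ c V ^ 2}) ∧
      (3 * ‖V‖ ^ 2 ≤ ‖U‖ ^ 2 →
        1 / 2 + κ ≤ (stdGaussian (EuclideanSpace ℝ (Fin n))).real
          {c | inner ℝ c V ^ 2 < inner ℝ c U ^ 2}))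
    (U₀ V₀ U₁ V₁ : EuclideanSpace ℝ (Fin n)) (h₀ : inner ℝ U₀ V₀ = 0) (h₁ : inner ℝ U₁ V₁ = 0)
    (heq : ‖U₀‖ = ‖V₀‖) (hpos : 0 < ‖U₀‖)
    (hrob : 2⁻¹ * (‖U₁‖ ^ 2 + ‖V₁‖ ^ 2) < |‖U₁‖ ^ 2 - ‖V₁‖ ^ 2|) :
    κ ≤ (stdGaussian (EuclideanSpace ℝ (Fin n))).real
      {c | (inner ℝ c U₀ ^ 2 - inner ℝ c V₀ ^ 2) * (inner ℝ c U₁ ^ 2 - inner ℝ c V₁ ^ 2) < 0} := by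
  have hV₀ : 0 < ‖V₀‖ := heq ▸ hpos
  have h₀' : inner ℝ V₀ U₀ = 0 := by rw [real_inner_comm]; exact h₀
  have h₁' : inner ℝ V₁ U₁ = 0 := by rw [real_inner_comm]; exact h₁
  have hmeas : ∀ X Y : EuclideanSpace ℝ (Fin n),
      MeasurableSet {c : EuclideanSpace ℝ (Fin n) | inner ℝ c X ^ 2 < inner ℝ c Y ^ 2} :=
    fun X Y => measurableSet_lt (by fun_prop) (by fun_prop)
  rcases lt_trichotomy (‖U₁‖ ^ 2 - ‖V₁‖ ^ 2) 0 with hlt | heq0 | hgt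
  · -- the negative block dominates at the robust point: sign pattern `+` then `-`
    rw [abs_of_neg hlt] at hrob
    have hV₁ : 0 < ‖V₁‖ := norm_pos_iff.mpr fun h0 => by
      rw [h0, norm_zero] at hlt
      nlinarith [sq_nonneg ‖U₁‖]
    refine le_measureReal_of_inter_subset _ (hmeas _ _) ((hG V₀ U₀ h₀' hV₀).1 heq.symm)
      ((hG V₁ U₁ h₁' hV₁).2 (by linarith)) fun c hc => ?_
    simp only [Set.mem_inter_iff, Set.mem_setOf_eq] at hc ⊢
    exact mul_neg_of_pos_of_neg (sub_pos.mpr hc.1) (sub_neg.mpr hc.2)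
  · exfalso
    rw [heq0, abs_zero] at hrob
    have : 0 ≤ (2 : ℝ)⁻¹ * (‖U₁‖ ^ 2 + ‖V₁‖ ^ 2) := by positivity
    linarith
  · -- the positive block dominates at the robust point: sign pattern `-` then `+`
    rw [abs_of_pos hgt] at hrob
    have hU₁ : 0 < ‖U₁‖ := norm_pos_iff.mpr fun h0 => by
      rw [h0, norm_zero] at hgt
      nlinarith [sq_nonneg ‖V₁‖]
    refine le_measureReal_of_inter_subset _ (hmeas _ _) ((hG U₀ V₀ h₀ hpos).1 heq)
      ((hG U₁ V₁ h₁ hU₁).2 (by linarith)) fun c hc => ?_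
    simp only [Set.mem_inter_iff, Set.mem_setOf_eq] at hc ⊢
    exact mul_neg_of_neg_of_pos (sub_neg.mpr hc.1) (sub_pos.mpr hc.2)

/-! ### The lifted sparse curve and the robust count -/

/-- Inner product against a coordinate vector of `EuclideanSpace ℝ (Fin n)`. [folklore] -/
theorem inner_toLp_right {n : ℕ} (c : EuclideanSpace ℝ (Fin n)) (q : Fin n → ℝ) :
    inner ℝ c (WithLp.toLp 2 q) = ∑ i, c i * q i := by
  simp [PiLp.inner_apply, mul_comm]

/-- Squared norm of a coordinate vector of `EuclideanSpace ℝ (Fin n)`. [folklore] -/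
theorem norm_sq_toLp {n : ℕ} (p : Fin n → ℝ) :
    ‖(WithLp.toLp 2 p : EuclideanSpace ℝ (Fin n))‖ ^ 2 = ∑ i, p i ^ 2 := by
  rw [EuclideanSpace.real_norm_sq_eq]

/-- **Robust excursions at good zeros cost `κ` each, and a Gaussian section pays at most `2S`.**
For `F = Σ aᵢgᵢ²`, `M = Σ|aᵢ|gᵢ²`, positive zeros `z₀ < ⋯ < z_N` of `F` and a set `T` of indices
`k` with a robust point `t_k ∈ (z_k, z_{k+1})` (`M(t_k)/2 < |F(t_k)|`) and `M(z_k) > 0`: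
`|T| · κ ≤ 2 Σ|supp gᵢ|`.  Lift to `U_x = (uᵢ gᵢ(x))ᵢ`, `V_x = (vᵢ gᵢ(x))ᵢ` (`uᵢ² - vᵢ² = aᵢ`,
`uᵢvᵢ = 0`); the event "`⟪c,U_x⟫² - ⟪c,V_x⟫²` changes sign between `z_k` and `t_k`" has
probability `≥ κ` (`le_measureReal_signChange`), while for every `c` it happens for at most
`2S` indices (`card_le_card_pos_roots_of_sign_changes`, `card_pos_roots_mul_linComb_le`);
integrate (`sum_measureReal_le_of_card_filter_le`). [folklore] -/
theorem card_mul_le_of_good {κ : ℝ}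
    (hG : ∀ (n : ℕ) (U V : EuclideanSpace ℝ (Fin n)), inner ℝ U V = 0 → 0 < ‖U‖ →
      (‖U‖ = ‖V‖ →
        (1 / 2 : ℝ) ≤ (stdGaussian (EuclideanSpace ℝ (Fin n))).real
          {c | inner ℝ c U ^ 2 < inner ℝ c V ^ 2}) ∧
      (3 * ‖V‖ ^ 2 ≤ ‖U‖ ^ 2 →
        1 / 2 + κ ≤ (stdGaussian (EuclideanSpace ℝ (Fin n))).real
          {c | inner ℝ c V ^ 2 < inner ℝ c U ^ 2}))
    {s : ℕ} (a : Fin s → ℝ) (g : Fin s → ℝ[X]) {N : ℕ} (z : Fin (N + 1) → ℝ) (hz : StrictMono z)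
    (hz0 : 0 < z 0) (hroot : ∀ k, (∑ i, C (a i) * g i ^ 2).eval (z k) = 0) (t : Fin N → ℝ)
    (T : Finset (Fin N))
    (hT : ∀ k ∈ T, z k.castSucc < t k ∧ t k < z k.succ ∧
      2⁻¹ * (∑ i, C (|a i|) * g i ^ 2).eval (t k) < |(∑ i, C (a i) * g i ^ 2).eval (t k)| ∧
      0 < (∑ i, C (|a i|) * g i ^ 2).eval (z k.castSucc)) :
    (T.card : ℝ) * κ ≤ 2 * ∑ i, (g i).support.card := by
  classical
  -- square roots of the positive and of the negative parts of the weights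
  obtain ⟨u, v, huv, hsub, hadd⟩ : ∃ u v : Fin s → ℝ, (∀ i, u i * v i = 0) ∧
      (∀ i, u i ^ 2 - v i ^ 2 = a i) ∧ (∀ i, u i ^ 2 + v i ^ 2 = |a i|) := by
    refine ⟨fun i => if 0 ≤ a i then √(a i) else 0, fun i => if 0 ≤ a i then 0 else √(-a i),
      fun i => ?_, fun i => ?_, fun i => ?_⟩
    · dsimp only
      split_ifs <;> simp
    · dsimp only
      split_ifs with h
      · rw [Real.sq_sqrt h]
        ring
      · rw [Real.sq_sqrt (by linarith)]
        ring
    · dsimp only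
      split_ifs with h
      · rw [Real.sq_sqrt h, abs_of_nonneg h]
        ring
      · rw [Real.sq_sqrt (by linarith), abs_of_neg (not_le.mp h)]
        ring
  -- the lifted sparse curve: positive block `U`, negative block `V`
  obtain ⟨U, hU⟩ : ∃ U : ℝ → EuclideanSpace ℝ (Fin s),
      ∀ x, U x = WithLp.toLp 2 (fun i => u i * (g i).eval x) := ⟨_, fun _ => rfl⟩
  obtain ⟨V, hV⟩ : ∃ V : ℝ → EuclideanSpace ℝ (Fin s),
      ∀ x, V x = WithLp.toLp 2 (fun i => v i * (g i).eval x) := ⟨_, fun _ => rfl⟩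
  have hUV : ∀ x, inner ℝ (U x) (V x) = 0 := fun x => by
    rw [hU, hV, inner_toLp_right]
    exact Finset.sum_eq_zero fun i _ => by rw [PiLp.toLp_apply, mul_mul_mul_comm, huv, zero_mul]
  have hF : ∀ x, ‖U x‖ ^ 2 - ‖V x‖ ^ 2 = (∑ i, C (a i) * g i ^ 2).eval x := fun x => by
    rw [hU, hV, norm_sq_toLp, norm_sq_toLp, eval_finsetSum, ← Finset.sum_sub_distrib]
    refine Finset.sum_congr rfl fun i _ => ?_
    rw [eval_mul, eval_C, eval_pow, mul_pow, mul_pow, ← sub_mul, hsub]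
  have hM : ∀ x, ‖U x‖ ^ 2 + ‖V x‖ ^ 2 = (∑ i, C (|a i|) * g i ^ 2).eval x := fun x => by
    rw [hU, hV, norm_sq_toLp, norm_sq_toLp, eval_finsetSum, ← Finset.sum_add_distrib]
    refine Finset.sum_congr rfl fun i _ => ?_
    rw [eval_mul, eval_C, eval_pow, mul_pow, mul_pow, ← add_mul, hadd]
  -- the Gaussian section `⟪c, U_x⟫² - ⟪c, V_x⟫² = ((L₊ - L₋)(L₊ + L₋))(x)`, a sparse product
  have hD : ∀ (c : EuclideanSpace ℝ (Fin s)) (x : ℝ),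
      ((∑ i, C (c i * (u i - v i)) * g i) * ∑ i, C (c i * (u i + v i)) * g i).eval x =
        inner ℝ c (U x) ^ 2 - inner ℝ c (V x) ^ 2 := fun c x => by
    rw [hU, hV, inner_toLp_right, inner_toLp_right]
    simp only [eval_mul, eval_finsetSum, eval_C, mul_sub, mul_add, sub_mul, add_mul,
      Finset.sum_sub_distrib, Finset.sum_add_distrib, mul_assoc]
    ring
  -- the sign-change events `E_k = {c | D_c(z_k) · D_c(t_k) < 0}`
  obtain ⟨Ev, hEv⟩ : ∃ Ev : Fin N → Set (EuclideanSpace ℝ (Fin s)), ∀ k, Ev k =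
      {c | (inner ℝ c (U (z k.castSucc)) ^ 2 - inner ℝ c (V (z k.castSucc)) ^ 2) *
        (inner ℝ c (U (t k)) ^ 2 - inner ℝ c (V (t k)) ^ 2) < 0} := ⟨_, fun _ => rfl⟩
  have hmeas : ∀ k, MeasurableSet (Ev k) := fun k => by
    rw [hEv]
    exact measurableSet_lt (by fun_prop) measurable_const
  -- (i) every event is likely
  have h1 : ∀ k ∈ T, κ ≤ (stdGaussian (EuclideanSpace ℝ (Fin s))).real (Ev k) := by
    intro k hk
    obtain ⟨-, -, hrob, hgood⟩ := hT k hk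
    have heq : ‖U (z k.castSucc)‖ = ‖V (z k.castSucc)‖ := by
      have h := hF (z k.castSucc)
      rw [hroot] at h
      exact (sq_eq_sq₀ (norm_nonneg _) (norm_nonneg _)).mp (by linarith)
    have hpos : 0 < ‖U (z k.castSucc)‖ := norm_pos_iff.mpr fun h0 => by
      have h := hM (z k.castSucc)
      rw [← heq, h0, norm_zero] at h
      linarith
    have hrob' : 2⁻¹ * (‖U (t k)‖ ^ 2 + ‖V (t k)‖ ^ 2) < |‖U (t k)‖ ^ 2 - ‖V (t k)‖ ^ 2| := by
      rw [hF, hM]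
      exact hrob
    rw [hEv]
    exact le_measureReal_signChange (hG s) _ _ _ _ (hUV _) (hUV _) heq hpos hrob'
  -- (ii) every `c` lies in at most `2S` of the events
  have h2 : ∀ c : EuclideanSpace ℝ (Fin s),
      (T.filter (fun k => c ∈ Ev k)).card ≤ 2 * ∑ i, (g i).support.card := by
    intro c
    refine (card_le_card_pos_roots_of_sign_changes z hz hz0 t
      ((∑ i, C (c i * (u i - v i)) * g i) * ∑ i, C (c i * (u i + v i)) * g i)
      (T.filter (fun k => c ∈ Ev k)) fun k hk => ?_).trans (card_pos_roots_mul_linComb_le _ _ _)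
    rw [Finset.mem_filter, hEv, Set.mem_setOf_eq] at hk
    obtain ⟨hkT, hkE⟩ := hk
    obtain ⟨ht1, ht2, -, -⟩ := hT k hkT
    refine ⟨ht1, ht2, ?_⟩
    rw [hD, hD]
    exact hkE
  -- (iii) integrate the counting function
  have h3 := sum_measureReal_le_of_card_filter_le (stdGaussian (EuclideanSpace ℝ (Fin s))) T Ev
    (fun k _ => hmeas k) _ h2
  calc (T.card : ℝ) * κ = ∑ _k ∈ T, κ := by rw [Finset.sum_const, nsmul_eq_mul]
    _ ≤ ∑ k ∈ T, (stdGaussian (EuclideanSpace ℝ (Fin s))).real (Ev k) := Finset.sum_le_sum h1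
    _ ≤ _ := by exact_mod_cast h3

/-- **Stub R of line `Sketch` (`stub_robustOfGaussPair`): the Gaussian-pair inequalities imply
the robust-excursion count.**  Given positive zeros `z₀ < z₁ < ⋯ < z_N` of `F = Σ aᵢgᵢ²` and a set
`K` of indices `k` whose excursion `(z_k, z_{k+1})` contains a robust point `t`
(`M(t)/2 < |F(t)|`, `M = Σ|aᵢ|gᵢ²`), `|K| ≤ C · Σ|supp gᵢ|` with `C = ⌈2/κ⌉₊ + 1`: indices with
`M(z_k) > 0` number at most `2S/κ` (`card_mul_le_of_good`), and indices with `M(z_k) = 0` make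
`z_k` a positive zero of a fixed genuinely occurring `g_{i₀}` (`a_{i₀} ≠ 0`, `g_{i₀} ≠ 0`, which
exists as `F ≠ 0`), hence number `< |supp g_{i₀}| ≤ S` by sparse Descartes. [folklore] -/
theorem stub_robustOfGaussPair :
    (∃ κ : ℝ, 0 < κ ∧ ∀ (n : ℕ) (U V : EuclideanSpace ℝ (Fin n)), inner ℝ U V = 0 → 0 < ‖U‖ →
      (‖U‖ = ‖V‖ →
        (1 / 2 : ℝ) ≤ (stdGaussian (EuclideanSpace ℝ (Fin n))).real {c | inner ℝ c U ^ 2 < inner ℝ c V ^ 2}) ∧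
      (3 * ‖V‖ ^ 2 ≤ ‖U‖ ^ 2 →
        1 / 2 + κ ≤ (stdGaussian (EuclideanSpace ℝ (Fin n))).real {c | inner ℝ c V ^ 2 < inner ℝ c U ^ 2})) →
    ∃ C : ℕ, ∀ (s : ℕ) (a : Fin s → ℝ) (g : Fin s → ℝ[X]) (N : ℕ) (z : Fin (N + 1) → ℝ)
      (K : Finset (Fin N)),
      StrictMono z → 0 < z 0 →
      (∀ k, (∑ i, Polynomial.C (a i) * g i ^ 2).eval (z k) = 0) →
      (∀ k ∈ K, ∃ t : ℝ, z k.castSucc < t ∧ t < z k.succ ∧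
        2⁻¹ * (∑ i, Polynomial.C (|a i|) * g i ^ 2).eval t < |(∑ i, Polynomial.C (a i) * g i ^ 2).eval t|) →
      K.card ≤ C * ∑ i, (g i).support.card := by
  rintro ⟨κ, hκ, hG⟩
  refine ⟨⌈2 / κ⌉₊ + 1, fun s a g N z K hz hz0 hroot hK => ?_⟩
  classical
  -- a robust point `t k` in every robust excursion
  choose! t ht using hK
  have hMnn : ∀ (x : ℝ) (i : Fin s), 0 ≤ (C (|a i|) * g i ^ 2).eval x := fun x i => by
    rw [eval_mul, eval_C, eval_pow]
    positivity
  rcases K.eq_empty_or_nonempty with rfl | ⟨k₀, hk₀⟩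
  · simp
  -- `F ≠ 0`, so some square genuinely occurs
  obtain ⟨i₀, ha₀, hg₀⟩ : ∃ i, a i ≠ 0 ∧ g i ≠ 0 := by
    by_contra hno
    push Not at hno
    have hF0 : (∑ i, C (a i) * g i ^ 2) = 0 := Finset.sum_eq_zero fun i _ => by
      by_cases hai : a i = 0
      · simp [hai]
      · simp [hno i hai]
    have h := (ht k₀ hk₀).2.2
    rw [hF0, eval_zero, abs_zero] at h
    have : 0 ≤ 2⁻¹ * (∑ i, C (|a i|) * g i ^ 2).eval (t k₀) := by
      rw [eval_finsetSum]
      exact mul_nonneg (by norm_num) (Finset.sum_nonneg fun i _ => hMnn _ i)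
    linarith
  -- GOOD indices (`M(z_k) > 0`): the Gaussian count
  obtain ⟨good, hgood_def⟩ : ∃ good : Fin N → Prop,
      ∀ k, good k ↔ 0 < (∑ i, C (|a i|) * g i ^ 2).eval (z k.castSucc) := ⟨_, fun _ => Iff.rfl⟩
  have hgood : ((K.filter good).card : ℝ) * κ ≤ 2 * ∑ i, (g i).support.card :=
    card_mul_le_of_good hG a g z hz hz0 hroot t (K.filter good) fun k hk => by
      rw [Finset.mem_filter, hgood_def] at hk
      exact ⟨(ht k hk.1).1, (ht k hk.1).2.1, (ht k hk.1).2.2, hk.2⟩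
  -- BAD indices (`M(z_k) = 0`): `z_k` is a positive zero of `g i₀`
  have hbad : (K.filter fun k => ¬ good k).card ≤ ∑ i, (g i).support.card := by
    calc (K.filter fun k => ¬ good k).card ≤ ((g i₀).roots.toFinset.filter (0 < ·)).card := by
          refine Finset.card_le_card_of_injOn (fun k => z k.castSucc) (fun k hk => ?_) ?_
          · have hk' := Finset.mem_filter.mp (Finset.mem_coe.mp hk)
            rw [hgood_def, not_lt] at hk'
            have hM0 : ∑ i, (C (|a i|) * g i ^ 2).eval (z k.castSucc) = 0 :=
              le_antisymm (by rw [← eval_finsetSum]; exact hk'.2)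
                (Finset.sum_nonneg fun i _ => hMnn _ i)
            rw [Finset.sum_eq_zero_iff_of_nonneg fun i _ => hMnn _ i] at hM0
            have hi := hM0 i₀ (Finset.mem_univ _)
            rw [eval_mul, eval_C, eval_pow, mul_eq_zero, abs_eq_zero,
              pow_eq_zero_iff two_ne_zero] at hi
            simp only [Finset.coe_filter, Set.mem_setOf_eq, Multiset.mem_toFinset, mem_roots hg₀,
              IsRoot.def]
            exact ⟨hi.resolve_left ha₀, lt_of_lt_of_le hz0 (hz.monotone (Fin.zero_le _))⟩
          · intro k _ k' _ hkk'
            exact Fin.castSucc_injective _ (hz.injective hkk')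
      _ ≤ (g i₀).support.card := (card_roots_toFinset_filter_pos_lt_card_support hg₀).le
      _ ≤ ∑ i, (g i).support.card :=
          Finset.single_le_sum (f := fun i => (g i).support.card) (fun i _ => Nat.zero_le _)
            (Finset.mem_univ i₀)
  -- bookkeeping: `|K| = #good + #bad ≤ ⌈2/κ⌉₊ · S + S`
  set S : ℕ := ∑ i, (g i).support.card with hS
  have hgoodN : (K.filter good).card ≤ ⌈2 / κ⌉₊ * S := by
    have h1 : (2 / κ : ℝ) ≤ ⌈2 / κ⌉₊ := Nat.le_ceil _
    have h0 : (0 : ℝ) ≤ S := Nat.cast_nonneg _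
    have h2 : ((K.filter good).card : ℝ) ≤ (⌈2 / κ⌉₊ : ℝ) * S := by
      rw [← le_div_iff₀ hκ] at hgood
      calc ((K.filter good).card : ℝ) ≤ 2 * (S : ℝ) / κ := hgood
        _ = 2 / κ * S := by ring
        _ ≤ ⌈2 / κ⌉₊ * S := mul_le_mul_of_nonneg_right h1 h0
    exact_mod_cast h2
  calc K.card = (K.filter good).card + (K.filter fun k => ¬ good k).card :=
        (Finset.card_filter_add_card_filter_not good).symm
    _ ≤ ⌈2 / κ⌉₊ * S + S := add_le_add hgoodN hbad
    _ = (⌈2 / κ⌉₊ + 1) * S := by ring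

end Summit.ValiantsHypothesis.ValiantsHypothesis.Theorems.SOSTauSOSTau
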